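import Mathlib
import Literature.Analysis.FluidPDE.Tao2016AveragedNS.SelfSimilarCascadeBlowup
import Literature.Analysis.FluidPDE.Tao2016AveragedNS.BoundedEternalSolutions
import Summits.NavierStokesRegularity.NavierStokesRegularity.Theses.TaoLadderRungTwoBreak

/-!
# Route TaoLadderRungTwoBreak, cruxes ⟨20419⟩ `NoSurvivingEternalViscBddOne`, ⟨20420⟩ `EternalRigidityViscBddOne`,
# ⟨20205⟩ `NoSurvivingDSSOne`: MONOTONICITY of the four BOUNDED predicates in the spread `R` and the exponent `a`,
# and the reduction of the three route decls to the cofinal set of INTEGER spreads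

MODEL lattice ODEs only (Tao 2016 §4 in the log-time variables of §6.4; the cell's table class `InTableClass R`, `m = 4`);
nothing in this file is a statement about the Navier–Stokes equations, and no stub, crux, rung or summit is proved by it
(`--supports stmt-NavierStokesRegularity-20419`).

The tree has the spread / exponent monotonicity of the UNBOUNDED predicates (`NoSurvivingDSS.of_le_spread`,
`NoSurvivingEternalFwd.of_le_spread`, `EternalRigidityFwd.of_le_spread`, `NoRobustBlowupBelow.of_le_spread`,
`noRobustBlowupBelow_of_nat_spreads`, `NoSurvivingEternalVisc.of_le`, …) but not of the BOUNDED pair of module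
`BoundedEternalSolutions` over which the live cruxes are typed.  This file supplies them:

* `noSurvivingEternalViscBdd_of_le_spread` / `_of_le`, `noSurvivingEternalBdd_of_le_spread` / `_of_le`,
  `noLoudLadder_of_le_spread`, `eternalRigidityViscBdd_of_le_spread` / `_mono` — the class `InTableClass R` grows with `R`
  (`InTableClass.mono`) and forward survival gets weaker as `a` grows (`EternalSurvivingFwd.mono`), so each Liouville
  predicate is ANTITONE in `R` and in `a`, and the rigidity predicate is antitone in `R`, monotone in `a`;
* BY NAME on the route decls: `noSurvivingEternalViscBddOne_iff_nat`, `noSurvivingEternalBddOne_iff_nat`,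
  `noLoudLadderOne_iff_nat`, `eternalRigidityViscBddOne_iff_nat`, `stubEternalLiouville_iff_nat` — each of ⟨20419⟩, (ρ0) ⟨20451⟩,
  (ρ+) ⟨20452⟩, ⟨20420⟩ and ⟨20205⟩'s registered `stub_eternalLiouville` is EQUIVALENT to its restriction to integer spreads
  `R = N`, `N ≥ 1` (indeed to any cofinal set of spreads): a certificate organised spread-by-spread over `ℕ` closes the item;
* `noSurvivingEternalBddOne_of_exponent` — (ρ0) at any ONE exponent `a ≥ 1` gives (ρ0) (recorded for the planners: by the cell's
  screens K1(a) is expected FALSE for `a ≥ 5/3` — Kolmogorov fronts are (S_a)-surviving there — so only `a ∈ [1, 5/3)` is live).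

HONEST LABEL: order-theoretic bookkeeping (a dozen short terms); (ρ0), (ρ+), (ω3), (ω4), ⟨20419⟩, ⟨20420⟩, ⟨20205⟩ and every
NS statement remain OPEN; rung 0.
-/

-- the summit and its single sub-problem share the name (CONVENTIONS §1)
set_option linter.dupNamespace false

namespace Summit.NavierStokesRegularity.NavierStokesRegularity.Theorems.NoSurvivingEternalViscBddOne.SpreadMonotone

open Literature.Analysis.FluidPDE Literature.Analysis.FluidPDE.TaoCascade
open Summit.NavierStokesRegularity.NavierStokesRegularity.Theses.TaoLadderRungTwoBreak

/-! ## Monotonicity of the bounded predicates -/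

/-- `NoSurvivingEternalViscBdd` is antitone in the spread: the class `InTableClass R` grows with `R`.
[cite: Tao2016AveragedNS, §6.1 (the table being compared); cell vocabulary (`InTableClass.mono`)] -/
theorem noSurvivingEternalViscBdd_of_le_spread {R R' a : ℝ} (hR : 0 < R) (hRR' : R ≤ R')
    (h : NoSurvivingEternalViscBdd R' a) : NoSurvivingEternalViscBdd R a := by
  obtain ⟨εs, hεs, H⟩ := h
  exact ⟨εs, hεs, fun ε₀ hε₀ hle α hα νh W hW hU => H ε₀ hε₀ hle α (hα.mono hR hRR') νh W hW hU⟩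

/-- `NoSurvivingEternalViscBdd` is antitone in the exponent: (S_a)-survival implies (S_{a'})-survival for `a ≤ a'`.
[cite: Tao2016AveragedNS, §4 (the viscous equation before Thm. 4.2); cell vocabulary (`EternalSurvivingFwd.mono`)] -/
theorem noSurvivingEternalViscBdd_of_le {R a a' : ℝ} (h : NoSurvivingEternalViscBdd R a') (haa : a ≤ a') :
    NoSurvivingEternalViscBdd R a := by
  obtain ⟨εs, hεs, H⟩ := h
  exact ⟨εs, hεs, fun ε₀ hε₀ hle α hα νh W hW hU hS =>
    H ε₀ hε₀ hle α hα νh W hW hU (hS.mono hε₀.le haa)⟩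

/-- `NoSurvivingEternalBdd` (the bounded INVISCID Liouville predicate, (ρ0)'s shape) is antitone in the spread.
[cite: Tao2016AveragedNS, §6.1; cell vocabulary (`InTableClass.mono`)] -/
theorem noSurvivingEternalBdd_of_le_spread {R R' a : ℝ} (hR : 0 < R) (hRR' : R ≤ R')
    (h : NoSurvivingEternalBdd R' a) : NoSurvivingEternalBdd R a := by
  obtain ⟨εs, hεs, H⟩ := h
  exact ⟨εs, hεs, fun ε₀ hε₀ hle α hα W hW hU => H ε₀ hε₀ hle α (hα.mono hR hRR') W hW hU⟩

/-- `NoSurvivingEternalBdd` is antitone in the exponent.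
[cite: Tao2016AveragedNS, §4; cell vocabulary (`EternalSurvivingFwd.mono`)] -/
theorem noSurvivingEternalBdd_of_le {R a a' : ℝ} (h : NoSurvivingEternalBdd R a') (haa : a ≤ a') :
    NoSurvivingEternalBdd R a := by
  obtain ⟨εs, hεs, H⟩ := h
  exact ⟨εs, hεs, fun ε₀ hε₀ hle α hα W hW hU hS => H ε₀ hε₀ hle α hα W hW hU (hS.mono hε₀.le haa)⟩

/-- `NoLoudLadder` ((ρ+)'s shape) is antitone in the spread.
[cite: Tao2016AveragedNS, §6.1; cell vocabulary (`InTableClass.mono`)] -/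
theorem noLoudLadder_of_le_spread {R R' : ℝ} (hR : 0 < R) (hRR' : R ≤ R') (h : NoLoudLadder R') :
    NoLoudLadder R := by
  obtain ⟨εs, hεs, H⟩ := h
  exact ⟨εs, hεs, fun ε₀ hε₀ hle α hα νh W hν hW hU hloud =>
    H ε₀ hε₀ hle α (hα.mono hR hRR') νh W hν hW hU hloud⟩

/-- `EternalRigidityViscBdd` (⟨20420⟩'s shape) is antitone in the spread: its hypothesis class grows with `R` and its
conclusion does not mention `R`.
[cite: Tao2016AveragedNS, §6.1; cell vocabulary (`InTableClass.mono`)] -/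
theorem eternalRigidityViscBdd_of_le_spread {R R' a : ℝ} (hR : 0 < R) (hRR' : R ≤ R')
    (h : EternalRigidityViscBdd R' a) : EternalRigidityViscBdd R a := by
  obtain ⟨εs, hεs, H⟩ := h
  exact ⟨εs, hεs, fun ε₀ hε₀ hle α X₀ hα hNG => H ε₀ hε₀ hle α X₀ (hα.mono hR hRR') hNG⟩

/-- `EternalRigidityViscBdd` is monotone in the exponent (the extracted eternal solution survives at every larger `a`).
[cite: Tao2016AveragedNS, §4; cell vocabulary (`EternalSurvivingFwd.mono`)] -/
theorem eternalRigidityViscBdd_mono {R a a' : ℝ} (h : EternalRigidityViscBdd R a) (haa : a ≤ a') :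
    EternalRigidityViscBdd R a' := by
  obtain ⟨εs, hεs, H⟩ := h
  refine ⟨εs, hεs, fun ε₀ hε₀ hle α X₀ hα hNG => ?_⟩
  obtain ⟨νh, W, hW, hU, hS⟩ := H ε₀ hε₀ hle α X₀ hα hNG
  exact ⟨νh, W, hW, hU, hS.mono hε₀.le haa⟩

/-! ## Integer spreads suffice (route decls by name) -/

/-- A predicate on spreads that is antitone above `0` holds at every `R ≥ 1` iff it holds at every integer `N ≥ 1`.
[folklore] -/
theorem forall_one_le_iff_nat {P : ℝ → Prop} (hP : ∀ {R R' : ℝ}, 0 < R → R ≤ R' → P R' → P R) :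
    (∀ R : ℝ, 1 ≤ R → P R) ↔ ∀ N : ℕ, 1 ≤ N → P (N : ℝ) := by
  constructor
  · intro h N hN
    exact h N (by exact_mod_cast hN)
  · intro h R hR
    obtain ⟨N, hN⟩ := exists_nat_ge R
    have hN1 : 1 ≤ N := by
      have : (1 : ℝ) ≤ (N : ℝ) := hR.trans hN
      exact_mod_cast this
    exact hP (lt_of_lt_of_le one_pos hR) hN (h N hN1)

/-- ⟨stmt-NavierStokesRegularity-20419⟩ BY NAME: K1ᵛ(1) holds iff it holds at every integer spread `N ≥ 1`.
[cite: Tao2016AveragedNS, §6.1; cell vocabulary] -/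
theorem noSurvivingEternalViscBddOne_iff_nat :
    NoSurvivingEternalViscBddOne ↔ ∀ N : ℕ, 1 ≤ N → NoSurvivingEternalViscBdd (N : ℝ) 1 :=
  forall_one_le_iff_nat fun hR hRR' h => noSurvivingEternalViscBdd_of_le_spread hR hRR' h

/-- (ρ0) ⟨stmt-NavierStokesRegularity-20451⟩ = registered stub `stub_noSurvivingEternalBddOne` of ⟨20419⟩ BY NAME: it holds iff
it holds at every integer spread `N ≥ 1`.
[cite: Tao2016AveragedNS, §6.1; cell vocabulary] -/
theorem noSurvivingEternalBddOne_iff_nat :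
    NoSurvivingEternalBddOne ↔ ∀ N : ℕ, 1 ≤ N → NoSurvivingEternalBdd (N : ℝ) 1 :=
  forall_one_le_iff_nat fun hR hRR' h => noSurvivingEternalBdd_of_le_spread hR hRR' h

/-- (ρ+) ⟨stmt-NavierStokesRegularity-20452⟩ = registered stub `stub_noLoudLadderOne` of ⟨20419⟩ BY NAME: it holds iff it holds at
every integer spread `N ≥ 1`.
[cite: Tao2016AveragedNS, §6.1; cell vocabulary] -/
theorem noLoudLadderOne_iff_nat :
    NoLoudLadderOne ↔ ∀ N : ℕ, 1 ≤ N → NoLoudLadder (N : ℝ) :=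
  forall_one_le_iff_nat (P := fun R => NoLoudLadder R) fun hR hRR' h => noLoudLadder_of_le_spread hR hRR' h

/-- ⟨stmt-NavierStokesRegularity-20420⟩ BY NAME: K2ᵛ(1) holds iff it holds at every integer spread `N ≥ 1`.
[cite: Tao2016AveragedNS, §6.1; cell vocabulary] -/
theorem eternalRigidityViscBddOne_iff_nat :
    EternalRigidityViscBddOne ↔ ∀ N : ℕ, 1 ≤ N → EternalRigidityViscBdd (N : ℝ) 1 :=
  forall_one_le_iff_nat fun hR hRR' h => eternalRigidityViscBdd_of_le_spread hR hRR' h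

/-- ⟨stmt-NavierStokesRegularity-20205⟩'s registered stub `stub_eternalLiouville` (signature VERBATIM on the left; it is
`∀ R ≥ 1, NoSurvivingEternalFwd R 1` by `rfl`, tree `stubEternalLiouville_iff`) holds iff it holds at every integer spread.
[cite: Tao2016AveragedNS, §6.1; cell vocabulary (`NoSurvivingEternalFwd.of_le_spread`)] -/
theorem stubEternalLiouville_iff_nat :
    (∀ R : ℝ, 1 ≤ R → ∃ εs : ℝ, 0 < εs ∧ ∀ ε₀ : ℝ, 0 < ε₀ → ε₀ ≤ εs →
      ∀ α : (Fin 4 → Fin 4 → Fin 4 → ℤ × ℤ × ℤ → ℝ), InTableClass R α →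
        ∀ W : ℤ → ℝ → Em 4, IsEternal ε₀ α W → ¬ EternalSurvivingFwd 1 ε₀ W) ↔
    ∀ N : ℕ, 1 ≤ N → NoSurvivingEternalFwd (N : ℝ) 1 :=
  forall_one_le_iff_nat (P := fun R => NoSurvivingEternalFwd R 1) fun hR hRR' h =>
    NoSurvivingEternalFwd.of_le_spread hR hRR' h

/-- ⟨stmt-NavierStokesRegularity-20205⟩ BY NAME: `NoSurvivingDSSOne` (= `∀ R ≥ 1, NoSurvivingDSS R 1` by `rfl`) holds iff it
holds at every integer spread `N ≥ 1`.
[cite: Tao2016AveragedNS, §6.1; cell vocabulary (`NoSurvivingDSS.of_le_spread`)] -/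
theorem noSurvivingDSSOne_iff_nat :
    NoSurvivingDSSOne ↔ ∀ N : ℕ, 1 ≤ N → NoSurvivingDSS (N : ℝ) 1 :=
  forall_one_le_iff_nat (P := fun R => NoSurvivingDSS R 1) fun hR hRR' h =>
    NoSurvivingDSS.of_le_spread hR hRR' h

/-! ## Exponents -/

/-- (ρ0) at any ONE exponent `a ≥ 1` gives (ρ0) ⟨20451⟩ / `stub_noSurvivingEternalBddOne` BY NAME (antitone in `a`).  Recorded for
the planners: by the cell's screens the predicate is expected FALSE for `a ≥ 5/3`, so only `a ∈ [1, 5/3)` is a live strengthening.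
[cite: Tao2016AveragedNS, §4; cell vocabulary] -/
theorem noSurvivingEternalBddOne_of_exponent {a : ℝ} (ha : 1 ≤ a)
    (h : ∀ R : ℝ, 1 ≤ R → NoSurvivingEternalBdd R a) : NoSurvivingEternalBddOne :=
  fun R hR => noSurvivingEternalBdd_of_le (h R hR) ha

/-- K1ᵛ at any ONE exponent `a ≥ 1` gives ⟨20419⟩ BY NAME (antitone in `a`).
[cite: Tao2016AveragedNS, §4; cell vocabulary] -/
theorem noSurvivingEternalViscBddOne_of_exponent {a : ℝ} (ha : 1 ≤ a)
    (h : ∀ R : ℝ, 1 ≤ R → NoSurvivingEternalViscBdd R a) : NoSurvivingEternalViscBddOne :=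
  fun R hR => noSurvivingEternalViscBdd_of_le (h R hR) ha

/-- ⟨20420⟩ at any ONE exponent `a ≤ 1` gives ⟨20420⟩ BY NAME (monotone in `a`).
[cite: Tao2016AveragedNS, §4; cell vocabulary] -/
theorem eternalRigidityViscBddOne_of_exponent {a : ℝ} (ha : a ≤ 1)
    (h : ∀ R : ℝ, 1 ≤ R → EternalRigidityViscBdd R a) : EternalRigidityViscBddOne :=
  fun R hR => eternalRigidityViscBdd_mono (h R hR) ha

end Summit.NavierStokesRegularity.NavierStokesRegularity.Theorems.NoSurvivingEternalViscBddOne.SpreadMonotone
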